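import Mathlib.Analysis.SpecialFunctions.PolarCoord
import Literature.Analysis.FluidPDE.PeriodicCylinderFlux
import Literature.Analysis.FluidPDE.Ferrari1993Continuation
import HarnessLib

/-!
# Integration in cylindrical coordinates on `ℝ³` and on the period cell of the cylinder

Topic `Literature/Analysis/FluidPDE`. The change-of-variables formula for the cylindrical
coordinates `Φ(r, θ, z) = (r cos θ, r sin θ, z)` of `PeriodicCylinderFlux.lean` (`cylCoord`, on
the parameter space `Fin 3 → ℝ`, `p 0 = r`, `p 1 = θ`, `p 2 = z`):

* `lintegral_eq_lintegral_cylCoord` — for every `F : ℝ³ → [0, ∞]`,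
  `∫⁻ F = ∫⁻_{r > 0, -π < θ < π} r · F(Φ(r, θ, z))`;
* `setLIntegral_cylinderCell_eq_lintegral_cylBoxOpen` — on the period cell
  `cylinderCell L = {r < 1} × (0, L)`:
  `∫⁻_{cell} F = ∫⁻_{(0,1) × (-π,π) × (0,L)} r · F(Φ p) dp` (`cylBoxOpen L`);
* `integral_eq_integral_cylCoord`, `setIntegral_cylinderCell_eq_integral_cylBoxOpen` — the same
  for the Bochner integral of `F : ℝ³ → E`.

No measurability or integrability hypotheses are needed (both sides are images of one another
under a measurable embedding with Jacobian `r`, as in Mathlib's planar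
`integral_comp_polarCoord_symm`). This is the keystone for analysis "up to the wall" `{r = 1}` of
the cylinder in physical variables — traces on the wall, the Gauss–Green identity with boundary
flux, `L^p` norms of fields given in the rotating frame — complementing
`PeriodicCylinderFlux.lean` / `KatoLaiPeriodicCylinderProofs.lean`, which work on the parameter
box without returning to physical space, and `PeriodicCylinderGaussGreen.lean`, which avoids the
change of variables by a cut-off argument. Written for the named facts of the Euler programme in
the periodic cylinder (`Ferrari1993_periodicCylinderHsEnergyInequality`,
`ShirotaYanagisawa1993_periodicCylinderLogDivCurlEstimate`, `KatoLai1984_periodicCylinderUniformExistence`).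

## Proof

`ℝ³ = EuclideanSpace ℝ (Fin 3)` is carried to `Fin 3 → ℝ` (`PiLp.volume_preserving_toLp`) and
rearranged to `ℝ × (ℝ × ℝ)`, `p ↦ (p 2, (p 0, p 1))` (`cylParamEquiv`, volume preserving:
`volume_preserving_piFinSuccAbove`, `volume_preserving_finTwoArrow`); there the map
`(z, q) ↦ (z, polarCoord.symm q)` is injective on `ℝ × polarCoord.target` with derivative
`id × DpolarCoord.symm` of determinant `r`, its image `ℝ × polarCoord.source` has full measure, and
Mathlib's change of variables `lintegral_image_eq_lintegral_abs_det_fderiv_mul` /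
`integral_image_eq_integral_abs_det_fderiv_smul` applies (`lintegral_comp_cylPolar`,
`integral_comp_cylPolar`); transporting back along `cylParamEquiv` gives the formulas, the
composite map being `Φ = cylCoord`. All statements are folklore calculus.

## Mathlib / tree search

Mathlib: `integral_comp_polarCoord_symm`, `lintegral_comp_polarCoord_symm` (plane),
`integral_comp_pi_polarCoord_symm` (products of planes), spherical coordinates
(`MeasureTheory.Measure.toSphere`); no cylindrical coordinates. Tree:
`lean search 'cylCoord|cylindrical'` — `PeriodicCylinderFlux` (frame, `cylCoord`, the boxes
`cylBox`, `cylBoxOpen`, flux identity on the box), no change-of-variables formula.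
-/

noncomputable section

open MeasureTheory Set Function Filter Topology TopologicalSpace WithLp Real
open scoped NNReal ENNReal

namespace Literature.Analysis.FluidPDE

/-! ### The parameter rearrangement `(r, θ, z) ↦ (z, (r, θ))` -/

/-- The rearrangement `p ↦ (p 2, (p 0, p 1))` of the parameter space `Fin 3 → ℝ` as a measurable
equivalence with `ℝ × (ℝ × ℝ)` (splitting off the last coordinate, `MeasurableEquiv.piFinSuccAbove`,
then `MeasurableEquiv.finTwoArrow`). [folklore] -/
def cylParamEquiv : (Fin 3 → ℝ) ≃ᵐ ℝ × (ℝ × ℝ) :=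
  (MeasurableEquiv.piFinSuccAbove (fun _ : Fin 3 => ℝ) 2).trans
    (MeasurableEquiv.prodCongr (MeasurableEquiv.refl ℝ) MeasurableEquiv.finTwoArrow)

/-- `cylParamEquiv p = (p 2, (p 0, p 1))`. [folklore] -/
@[simp]
theorem cylParamEquiv_apply (p : Fin 3 → ℝ) : cylParamEquiv p = (p 2, (p 0, p 1)) := rfl

/-- `cylParamEquiv.symm (z, (r, θ)) = (r, θ, z)`. [folklore] -/
theorem cylParamEquiv_symm_apply (z r θ : ℝ) :
    cylParamEquiv.symm (z, (r, θ)) = ![r, θ, z] := by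
  apply cylParamEquiv.injective
  rw [MeasurableEquiv.apply_symm_apply]
  rfl

/-- First component of `cylParamEquiv.symm w`: the radius `w.2.1`. [folklore] -/
@[simp] theorem cylParamEquiv_symm_apply_zero (w : ℝ × (ℝ × ℝ)) :
    cylParamEquiv.symm w 0 = w.2.1 := by
  obtain ⟨z, r, θ⟩ := w; rw [cylParamEquiv_symm_apply]; rfl

/-- Second component of `cylParamEquiv.symm w`: the angle `w.2.2`. [folklore] -/
@[simp] theorem cylParamEquiv_symm_apply_one (w : ℝ × (ℝ × ℝ)) :
    cylParamEquiv.symm w 1 = w.2.2 := by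
  obtain ⟨z, r, θ⟩ := w; rw [cylParamEquiv_symm_apply]; rfl

/-- Third component of `cylParamEquiv.symm w`: the height `w.1`. [folklore] -/
@[simp] theorem cylParamEquiv_symm_apply_two (w : ℝ × (ℝ × ℝ)) :
    cylParamEquiv.symm w 2 = w.1 := by
  obtain ⟨z, r, θ⟩ := w; rw [cylParamEquiv_symm_apply]; rfl

/-- `cylParamEquiv` preserves Lebesgue measure. [folklore] -/
theorem volume_preserving_cylParamEquiv : MeasurePreserving cylParamEquiv volume volume :=
  (volume_preserving_piFinSuccAbove (fun _ : Fin 3 => ℝ) 2).trans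
    ((MeasurePreserving.id volume).prod (volume_preserving_finTwoArrow ℝ))

/-! ### The polar step on `ℝ × (ℝ × ℝ)` -/

/-- Lebesgue measure on `ℝ × (ℝ × ℝ)` is an additive Haar measure (product of Haar measures).
[folklore] -/
instance : (volume : Measure (ℝ × (ℝ × ℝ))).IsAddHaarMeasure :=
  Measure.prod.instIsAddHaarMeasure _ _

/-- The set `ℝ × polarCoord.source` has full measure in `ℝ × (ℝ × ℝ)`. [folklore] -/
theorem univ_prod_polarCoord_source_ae_eq_univ :
    ((univ : Set ℝ) ×ˢ polarCoord.source : Set (ℝ × (ℝ × ℝ))) =ᵐ[volume] univ := by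
  rw [ae_eq_univ]
  have hc : ((univ : Set ℝ) ×ˢ polarCoord.source)ᶜ = (univ : Set ℝ) ×ˢ polarCoord.sourceᶜ := by
    ext w; simp [mem_prod]
  have h0 : volume (polarCoord.sourceᶜ) = 0 := ae_eq_univ.1 polarCoord_source_ae_eq_univ
  rw [hc, show (volume : Measure (ℝ × (ℝ × ℝ))) = (volume : Measure ℝ).prod volume from rfl,
    Measure.prod_prod, h0, mul_zero]

/-- Determinant of `id × DpolarCoord.symm`: `r`. [folklore] -/
theorem det_id_prodMap_fderivPolarCoordSymm (w : ℝ × (ℝ × ℝ)) :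
    ((ContinuousLinearMap.id ℝ ℝ).prodMap (fderivPolarCoordSymm w.2)).det = w.2.1 := by
  rw [← det_fderivPolarCoordSymm w.2]
  simp only [ContinuousLinearMap.det, ContinuousLinearMap.coe_prodMap, ContinuousLinearMap.coe_id,
    LinearMap.det_prodMap, LinearMap.det_id, one_mul]

/-- **Polar coordinates in the second factor of `ℝ × ℝ²`**, `[0,∞]`-valued form: for every `G`,
`∫⁻_{ℝ × ((0,∞) × (-π,π))} r · G(z, polarCoord.symm (r, θ)) = ∫⁻ G`. [folklore] -/
theorem lintegral_comp_cylPolar (G : ℝ × (ℝ × ℝ) → ℝ≥0∞) :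
    ∫⁻ w in (univ : Set ℝ) ×ˢ polarCoord.target,
        ENNReal.ofReal w.2.1 * G (w.1, polarCoord.symm w.2) = ∫⁻ w, G w := by
  symm
  set U : Set (ℝ × (ℝ × ℝ)) := (univ : Set ℝ) ×ˢ polarCoord.target with hU_def
  set Ψ : ℝ × (ℝ × ℝ) → ℝ × (ℝ × ℝ) := Prod.map id polarCoord.symm with hΨ
  set Ψ' : ℝ × (ℝ × ℝ) → (ℝ × (ℝ × ℝ) →L[ℝ] ℝ × (ℝ × ℝ)) := fun w =>
    (ContinuousLinearMap.id ℝ ℝ).prodMap (fderivPolarCoordSymm w.2) with hΨ'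
  have hU : MeasurableSet U := MeasurableSet.univ.prod polarCoord.open_target.measurableSet
  have hderiv : ∀ w ∈ U, HasFDerivWithinAt Ψ (Ψ' w) U w := fun w _ =>
    ((hasFDerivAt_id w.1).prodMap w (hasFDerivAt_polarCoord_symm w.2)).hasFDerivWithinAt
  have hinj : InjOn Ψ U := by
    rintro ⟨z, q⟩ ⟨-, hq⟩ ⟨z', q'⟩ ⟨-, hq'⟩ h
    simp only [hΨ, Prod.map_apply, id_eq, Prod.mk.injEq] at h
    exact Prod.ext h.1 (polarCoord.symm.injOn hq hq' h.2)
  have himage : Ψ '' U = (univ : Set ℝ) ×ˢ polarCoord.source := by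
    rw [hΨ, hU_def, prodMap_image_prod, image_id, polarCoord.symm_image_target_eq_source]
  calc ∫⁻ w, G w = ∫⁻ w in (univ : Set ℝ) ×ˢ polarCoord.source, G w := by
        rw [← setLIntegral_univ]
        exact setLIntegral_congr univ_prod_polarCoord_source_ae_eq_univ.symm
    _ = ∫⁻ w in Ψ '' U, G w := by rw [himage]
    _ = ∫⁻ w in U, ENNReal.ofReal |(Ψ' w).det| * G (Ψ w) :=
        lintegral_image_eq_lintegral_abs_det_fderiv_mul volume hU hderiv hinj G
    _ = ∫⁻ w in U, ENNReal.ofReal w.2.1 * G (w.1, polarCoord.symm w.2) := by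
        refine setLIntegral_congr_fun hU fun w hw => ?_
        rw [hΨ', det_id_prodMap_fderivPolarCoordSymm, abs_of_pos hw.2.1]
        rfl

/-- **Polar coordinates in the second factor of `ℝ × ℝ²`**, Bochner form: for every `G`,
`∫_{ℝ × ((0,∞) × (-π,π))} r • G(z, polarCoord.symm (r, θ)) = ∫ G`. [folklore] -/
theorem integral_comp_cylPolar {E : Type*} [NormedAddCommGroup E] [NormedSpace ℝ E]
    (G : ℝ × (ℝ × ℝ) → E) :
    ∫ w in (univ : Set ℝ) ×ˢ polarCoord.target, w.2.1 • G (w.1, polarCoord.symm w.2) =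
      ∫ w, G w := by
  symm
  set U : Set (ℝ × (ℝ × ℝ)) := (univ : Set ℝ) ×ˢ polarCoord.target with hU_def
  set Ψ : ℝ × (ℝ × ℝ) → ℝ × (ℝ × ℝ) := Prod.map id polarCoord.symm with hΨ
  set Ψ' : ℝ × (ℝ × ℝ) → (ℝ × (ℝ × ℝ) →L[ℝ] ℝ × (ℝ × ℝ)) := fun w =>
    (ContinuousLinearMap.id ℝ ℝ).prodMap (fderivPolarCoordSymm w.2) with hΨ'
  have hU : MeasurableSet U := MeasurableSet.univ.prod polarCoord.open_target.measurableSet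
  have hderiv : ∀ w ∈ U, HasFDerivWithinAt Ψ (Ψ' w) U w := fun w _ =>
    ((hasFDerivAt_id w.1).prodMap w (hasFDerivAt_polarCoord_symm w.2)).hasFDerivWithinAt
  have hinj : InjOn Ψ U := by
    rintro ⟨z, q⟩ ⟨-, hq⟩ ⟨z', q'⟩ ⟨-, hq'⟩ h
    simp only [hΨ, Prod.map_apply, id_eq, Prod.mk.injEq] at h
    exact Prod.ext h.1 (polarCoord.symm.injOn hq hq' h.2)
  have himage : Ψ '' U = (univ : Set ℝ) ×ˢ polarCoord.source := by
    rw [hΨ, hU_def, prodMap_image_prod, image_id, polarCoord.symm_image_target_eq_source]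
  calc ∫ w, G w = ∫ w in (univ : Set ℝ) ×ˢ polarCoord.source, G w := by
        rw [← setIntegral_univ]
        exact (setIntegral_congr_set univ_prod_polarCoord_source_ae_eq_univ).symm
    _ = ∫ w in Ψ '' U, G w := by rw [himage]
    _ = ∫ w in U, |(Ψ' w).det| • G (Ψ w) :=
        integral_image_eq_integral_abs_det_fderiv_smul volume hU hderiv hinj G
    _ = ∫ w in U, w.2.1 • G (w.1, polarCoord.symm w.2) := by
        refine setIntegral_congr_fun hU fun w hw => ?_
        rw [hΨ', det_id_prodMap_fderivPolarCoordSymm, abs_of_pos hw.2.1]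
        rfl

/-! ### Cylindrical coordinates on `ℝ³` -/

/-- The composite of the rearrangement, planar polar coordinates and the return to physical space
is `cylCoord`: `toLp 2 (cylParamEquiv.symm (z, polarCoord.symm (r, θ))) = Φ(r, θ, z)`. [folklore] -/
theorem toLp_cylParamEquiv_symm_polarCoord_symm (p : Fin 3 → ℝ) :
    toLp 2 (cylParamEquiv.symm (p 2, polarCoord.symm (p 0, p 1))) = cylCoord p := by
  ext i
  fin_cases i <;> simp [polarCoord_symm_apply]

/-- The region `{r > 0, -π < θ < π}` of parameter space carried by cylindrical coordinates. [folklore] -/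
theorem cylParamEquiv_preimage_univ_prod_target :
    cylParamEquiv ⁻¹' ((univ : Set ℝ) ×ˢ polarCoord.target) =
      {p : Fin 3 → ℝ | 0 < p 0 ∧ p 1 ∈ Ioo (-π) π} := by
  ext p
  simp [polarCoord_target, mem_prod]

/-- **Integration in cylindrical coordinates on `ℝ³`, `[0,∞]`-valued form**: for every
`F : ℝ³ → [0, ∞]`, `∫⁻ F = ∫⁻_{r > 0, -π < θ < π} r · F(r cos θ, r sin θ, z) d(r, θ, z)` (the
half-plane `{θ = π}` and the axis are null). [folklore] -/
theorem lintegral_eq_lintegral_cylCoord (F : EuclideanSpace ℝ (Fin 3) → ℝ≥0∞) :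
    ∫⁻ x, F x = ∫⁻ p in {p : Fin 3 → ℝ | 0 < p 0 ∧ p 1 ∈ Ioo (-π) π},
      ENNReal.ofReal (p 0) * F (cylCoord p) := by
  have h1 : ∫⁻ x, F x = ∫⁻ q : Fin 3 → ℝ, F (toLp 2 q) :=
    ((PiLp.volume_preserving_toLp (Fin 3)).lintegral_comp_emb
      (MeasurableEquiv.toLp 2 (Fin 3 → ℝ)).measurableEmbedding F).symm
  have h2 : ∫⁻ q : Fin 3 → ℝ, F (toLp 2 q) =
      ∫⁻ w : ℝ × (ℝ × ℝ), F (toLp 2 (cylParamEquiv.symm w)) :=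
    ((volume_preserving_cylParamEquiv.symm _).lintegral_comp_emb
      cylParamEquiv.symm.measurableEmbedding (fun q => F (toLp 2 q))).symm
  have h3 := lintegral_comp_cylPolar (fun w => F (toLp 2 (cylParamEquiv.symm w)))
  have h4 := volume_preserving_cylParamEquiv.setLIntegral_comp_preimage_emb
    cylParamEquiv.measurableEmbedding
    (fun w => ENNReal.ofReal w.2.1 * F (toLp 2 (cylParamEquiv.symm (w.1, polarCoord.symm w.2))))
    ((univ : Set ℝ) ×ˢ polarCoord.target)
  rw [h1, h2, ← h3, ← h4, cylParamEquiv_preimage_univ_prod_target]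
  refine setLIntegral_congr_fun (by measurability) fun p _ => ?_
  simp only [cylParamEquiv_apply, toLp_cylParamEquiv_symm_polarCoord_symm]

/-- **Integration in cylindrical coordinates on `ℝ³`**, Bochner form: for every `F : ℝ³ → E`,
`∫ F = ∫_{r > 0, -π < θ < π} r • F(r cos θ, r sin θ, z) d(r, θ, z)`. [folklore] -/
theorem integral_eq_integral_cylCoord {E : Type*} [NormedAddCommGroup E] [NormedSpace ℝ E]
    (F : EuclideanSpace ℝ (Fin 3) → E) :
    ∫ x, F x = ∫ p in {p : Fin 3 → ℝ | 0 < p 0 ∧ p 1 ∈ Ioo (-π) π}, (p 0) • F (cylCoord p) := by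
  have h1 : ∫ x, F x = ∫ q : Fin 3 → ℝ, F (toLp 2 q) :=
    ((PiLp.volume_preserving_toLp (Fin 3)).integral_comp
      (MeasurableEquiv.toLp 2 (Fin 3 → ℝ)).measurableEmbedding F).symm
  have h2 : ∫ q : Fin 3 → ℝ, F (toLp 2 q) =
      ∫ w : ℝ × (ℝ × ℝ), F (toLp 2 (cylParamEquiv.symm w)) :=
    ((volume_preserving_cylParamEquiv.symm _).integral_comp
      cylParamEquiv.symm.measurableEmbedding (fun q => F (toLp 2 q))).symm
  have h3 := integral_comp_cylPolar (fun w => F (toLp 2 (cylParamEquiv.symm w)))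
  have h4 := volume_preserving_cylParamEquiv.setIntegral_preimage_emb
    cylParamEquiv.measurableEmbedding
    (fun w => w.2.1 • F (toLp 2 (cylParamEquiv.symm (w.1, polarCoord.symm w.2))))
    ((univ : Set ℝ) ×ˢ polarCoord.target)
  rw [h1, h2, ← h3, ← h4, cylParamEquiv_preimage_univ_prod_target]
  refine setIntegral_congr_fun (by measurability) fun p _ => ?_
  simp only [cylParamEquiv_apply, toLp_cylParamEquiv_symm_polarCoord_symm]

/-! ### The period cell -/

/-- Membership in the open parameter box `cylBoxOpen L = (0,1) × (-π,π) × (0,L)`. [folklore] -/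
theorem mem_cylBoxOpen_iff {L : ℝ} {p : Fin 3 → ℝ} :
    p ∈ cylBoxOpen L ↔ p 0 ∈ Ioo 0 1 ∧ p 1 ∈ Ioo (-π) π ∧ p 2 ∈ Ioo 0 L := by
  simp [cylBoxOpen, cylBoxLo, cylBoxHi, Fin.forall_fin_succ]

/-- The part of the region `{r > 0, -π < θ < π}` mapped into the period cell is the open box
`cylBoxOpen L`. [folklore] -/
theorem region_inter_preimage_cylinderCell (L : ℝ) :
    {p : Fin 3 → ℝ | 0 < p 0 ∧ p 1 ∈ Ioo (-π) π} ∩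
        cylCoord ⁻¹' (cylinderCell L : Set (EuclideanSpace ℝ (Fin 3))) = cylBoxOpen L := by
  ext p
  simp only [mem_inter_iff, mem_setOf_eq, mem_preimage, SetLike.mem_coe, mem_cylinderCell,
    cylCoord_apply_two, mem_cylBoxOpen_iff, mem_Ioo]
  constructor
  · rintro ⟨⟨h0, h1⟩, hr, h2⟩
    rw [cylRadius_cylCoord h0.le] at hr
    exact ⟨⟨h0, hr⟩, h1, h2⟩
  · rintro ⟨⟨h0, hr⟩, h1, h2⟩
    refine ⟨⟨h0, h1⟩, ?_, h2⟩
    rw [cylRadius_cylCoord h0.le]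
    exact hr

/-- **Integration over the period cell in cylindrical coordinates**, `[0,∞]`-valued form:
`∫⁻_{{r<1} × (0,L)} F = ∫⁻_{(0,1) × (-π,π) × (0,L)} r · F(Φ p) dp` for every `F : ℝ³ → [0,∞]`.
[folklore] -/
theorem setLIntegral_cylinderCell_eq_lintegral_cylBoxOpen (L : ℝ)
    (F : EuclideanSpace ℝ (Fin 3) → ℝ≥0∞) :
    ∫⁻ x in (cylinderCell L : Set (EuclideanSpace ℝ (Fin 3))), F x =
      ∫⁻ p in cylBoxOpen L, ENNReal.ofReal (p 0) * F (cylCoord p) := by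
  have hR : MeasurableSet {p : Fin 3 → ℝ | 0 < p 0 ∧ p 1 ∈ Ioo (-π) π} := by measurability
  have hcellm : MeasurableSet (cylCoord ⁻¹' (cylinderCell L : Set (EuclideanSpace ℝ (Fin 3)))) :=
    (cylinderCell L).isOpen.measurableSet.preimage continuous_cylCoord.measurable
  rw [← lintegral_indicator (cylinderCell L).isOpen.measurableSet, lintegral_eq_lintegral_cylCoord]
  have e : (fun p : Fin 3 → ℝ => ENNReal.ofReal (p 0) *
      (cylinderCell L : Set (EuclideanSpace ℝ (Fin 3))).indicator F (cylCoord p)) =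
      (cylCoord ⁻¹' (cylinderCell L : Set (EuclideanSpace ℝ (Fin 3)))).indicator
        fun p => ENNReal.ofReal (p 0) * F (cylCoord p) := by
    funext p
    classical
    simp only [indicator_apply, mem_preimage]
    split_ifs <;> simp
  rw [e, lintegral_indicator hcellm, Measure.restrict_restrict hcellm, inter_comm,
    region_inter_preimage_cylinderCell]

/-- **Integration over the period cell in cylindrical coordinates**, Bochner form:
`∫_{{r<1} × (0,L)} F = ∫_{(0,1) × (-π,π) × (0,L)} r • F(Φ p) dp` for every `F : ℝ³ → E`.
[folklore] -/
theorem setIntegral_cylinderCell_eq_integral_cylBoxOpen {E : Type*} [NormedAddCommGroup E]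
    [NormedSpace ℝ E] (L : ℝ) (F : EuclideanSpace ℝ (Fin 3) → E) :
    ∫ x in (cylinderCell L : Set (EuclideanSpace ℝ (Fin 3))), F x =
      ∫ p in cylBoxOpen L, (p 0) • F (cylCoord p) := by
  have hcellm : MeasurableSet (cylCoord ⁻¹' (cylinderCell L : Set (EuclideanSpace ℝ (Fin 3)))) :=
    (cylinderCell L).isOpen.measurableSet.preimage continuous_cylCoord.measurable
  rw [← integral_indicator (cylinderCell L).isOpen.measurableSet, integral_eq_integral_cylCoord]
  have e : (fun p : Fin 3 → ℝ => (p 0) •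
      (cylinderCell L : Set (EuclideanSpace ℝ (Fin 3))).indicator F (cylCoord p)) =
      (cylCoord ⁻¹' (cylinderCell L : Set (EuclideanSpace ℝ (Fin 3)))).indicator
        fun p => (p 0) • F (cylCoord p) := by
    funext p
    classical
    simp only [indicator_apply, mem_preimage]
    split_ifs <;> simp
  rw [e, integral_indicator hcellm, Measure.restrict_restrict hcellm, inter_comm,
    region_inter_preimage_cylinderCell]

end Literature.Analysis.FluidPDE
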